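import Literature.MathematicalPhysics.QuantumFieldTheory.Balaban1983to89.Node00.TwoRunSiteComponents

/-!
# NODE 00 — THE COMPONENT-SIZE («OVER-AGE») READING OF THE TWO-RUN SITE KEY: a key is booked iff at some OLD level `1 ≤ j ≤ jcut` the large-field region
# `Z_j = Λ_jᶜ` has a connected component that is BIG for its level (`big j`, a DIAL); the record's persistence reading is the `⊤` corner of the dial, the
# free (cut-zero) face is its `⊥` corner, and EVERY dial value is a sub-reading of the record's

Cell `pub-ymgap`, YM-PLAN Track A (HUMAN RULING D-0062; width push D-0149); seat `pub-ymgap-dag-n20-d` (R134 (a) N20 NE7b s3) gen 32 — continuation of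
`Node00/TwoRunSite{Transport,Key,Lift,Persistence,Window,Components}` (p561554 ∕ p570161 ∕ p575738 ∕ p583644 ∕ p608088 ∕ p615381).  [III] = [Balaban1988Convergent],
[LF-I] = [Balaban1989LargeFieldI], [LF-II] = [Balaban1989LargeFieldII].

WHY.  The bad class NE7b must weigh is «the terms carrying OLD PENDING large-field structure» (`T4WeightBudget.RelWeightBound`, docstring).  At node U5d's key of record
(the (2.18) index, cumulative: `Node00/TwoRunSitePersistence.KeyOldLargeField jcut x` = «a large-field region at some level `1 ≤ j ≤ jcut`») «old» is readable but «pending»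
is not, and «old» alone is EXTENSIVE: by the cell's count the first-level class should carry asymptotically all of a run's mass, so every cut policy carrying a relative weight
bound is eventually the zero cut (`Summits/…/BalabanUVNodesN20KeyedRelWeightPolicyWall`, located).  Print ties pendency to SIZE: a component `Z` of the large-field region of
the `j`-th step carries `exp(−κ_j(Z))`, which «controls `K` renormalization steps … where the number `K` is the smallest positive integer having the property that the domain
`S^K(Z)`, considered as a domain in the lattice of the scale `L^{−(j+K)}`, satisfies the conditions (i), (ii), with `N = R_j`» ([LF-II] p.384, (1.80)), and «Let `n₀` be the last
index `n` such that `d′_n(Z^{(n−j)}) > 0`. Then `S^{n₀+1−j}(Z)` is contained in a cube of the size `64MR_{n₀+1}` … Thus `K ≤ n₀ − j + R_j`» ([LF-II] p.385, before (1.81)); a small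
new region pends `R_{j+1}` steps only («`Z` is a small domain, it is contained in a cube of the size `100MR_{j+1}`, hence `K = R_{j+1}`», p.386).  So a component STILL
pending many steps after its birth is one whose cover kept a positive reduced size over many scales — a BIG component: {over-aged pending structure} ⊆ {an old level carries a
big component} (the proxy direction; read qualitatively from (1.81), NOT typed — the tree has no pendency).  The forgiving window of `Node00/TwoRunSiteComponents` forgives
size-blind and the floor-volume reading of `Node00/TwoRunSiteWindow` (`largeFieldVolume`) is a TOTAL volume at one level; this file types the PER-COMPONENT size reading, with
the size criterion left as a dial `big : ℕ → Set α → Prop` (level ↦ which components count), so that the N20 ∕ N19′ pens can book «old AND big» instead of «old».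
WHAT IS TYPED (pure set algebra; any type `α`, any touching relation `τ`).  §1 `compIn τ S z := {z′ | ConnIn τ S z z′}` — the component of `S` through `z` (chains of touching
steps inside `S`, `Node00/TwoRunSiteComponents.ConnIn`); `HasBigComponent τ big S := ∃ z ∈ S, big (compIn τ S z)`; monotone in `big`; the `⊤` dial reads `S.Nonempty`, the `⊥` dial
reads nothing; `absorbed τ R S` is the union of the components through `S ∩ R`.  §2 ★ `KeyBigOldComponent τ big jcut x := ∃ j, 1 ≤ j ∧ j ≤ jcut ∧ HasBigComponent τ (big j)
(x.2 j)ᶜ` with: ★ `keyOldLargeField_of_keyBigOldComponent` (every dial value is a SUB-reading of the record's persistence reading), ★ `keyBigOldComponent_top_iff` (`big := ⊤`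
IS the record's reading), `not_keyBigOldComponent_bot` (`big := ⊥` books nothing — the cut-zero face), monotone in the cut and in the dial, level bookkeeping
(`keyBigOldComponent_succ_iff`), the all-small key is never booked, ★ `keyBigOldComponent_windowKey_iff` (composed with the level window of `Node00/TwoRunSiteWindow` only the
levels `(c, jcut]` are read), and growth along an antitone (cumulative) key for a set-monotone dial.  §3 the cardinality dial `bigOfCard m j C := m j ≤ C.ncard` (threshold `m j`
finest sites at level `j`): antitone in `m`; `m ≡ 0` and (finite `α`) `m ≡ 1` give the record's reading back; a threshold above `Nat.card α` books nothing.  §4 the torus instance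
(`SiteTouch` of `Node00/TwoRunSiteComponents`, sites `Site (F.P Kc) 0`): components are symmetric (`mem_compIn_siteTouch_comm`), and the reading on node U5d's `SiteSeqKey`.
HONEST — WHAT THIS IS NOT.  NOT Bałaban's (1.80): no operation `S`, no conditions (i), (ii), no numbers `R_j`, `M`, no reduced size `d′_n`, no cube geometry (site-level touching
only, as in p615381); the inclusion {over-aged pending} ⊆ {old-big} is print's (1.81) read qualitatively and stated HERE IN PROSE, not as a theorem; which thresholds `m j` (if
any) make the booked class RARE under Bałaban's densities is a Peierls-type COUNT (connected site-sets through a point against `exp(−O(1)p₀(g_j)²)` per block) — NOT PRINTED as a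
two-run statement, NOT proved, and NOT displayed as a hypothesis anywhere in this file.  No weight, no estimate; NE7 ∕ NE7b ∕ NE7c NOT PRINTED for `d = 4` and NOT proved; nothing
of Bałaban's asserted; no node count moves (typed 28∕28 · discharged 8∕27); no `sorry`, no `axiom`, no `instance`, no `notation`; one finite four-torus programme at fixed `ε` —
NOT ℝ⁴, NOT OS, NOT a mass gap, NOT the Clay problem.
-/

noncomputable section

namespace Literature.MathematicalPhysics.QuantumFieldTheory.Balaban1983to89.Node00

open T4Continuum B14.Eq213MaximalDomains B15Eq112TorusCover B14DomainGeom B14.Eq218Concrete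

/-! ## §1  The component of a set through a point; sets with a big component -/

section Components

variable {α : Type*} (τ : α → α → Prop)

/-- **THE COMPONENT OF `S` THROUGH `z`**: the points reachable from `z` by chains of touching steps inside `S` (print's «connected domain», chained).
[cite: Balaban1989LargeFieldII, (1.84) p.386 (bookkeeping)] -/
def compIn (S : Set α) (z : α) : Set α :=
  {z' | ConnIn τ S z z'}

/-- Membership, unfolded. [cite: Balaban1989LargeFieldII, (1.84) p.386 (bookkeeping)] -/
theorem mem_compIn_iff (S : Set α) (z z' : α) : z' ∈ compIn τ S z ↔ ConnIn τ S z z' :=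
  Iff.rfl

/-- A point lies in its own component. [cite: Balaban1989LargeFieldII, (1.84) p.386 (bookkeeping)] -/
theorem mem_compIn_self (S : Set α) (z : α) : z ∈ compIn τ S z :=
  connIn_refl τ S z

/-- Components are nonempty. [cite: Balaban1989LargeFieldII, (1.84) p.386 (bookkeeping)] -/
theorem compIn_nonempty (S : Set α) (z : α) : (compIn τ S z).Nonempty :=
  ⟨z, mem_compIn_self τ S z⟩

/-- The component through a point OF `S` lies in `S`. [cite: Balaban1989LargeFieldII, (1.84) p.386 (bookkeeping)] -/
theorem compIn_subset {S : Set α} {z : α} (hz : z ∈ S) : compIn τ S z ⊆ S :=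
  fun _ h => h.mem τ hz

/-- Components grow with the set. [cite: Balaban1989LargeFieldII, (1.85) p.386 (bookkeeping)] -/
theorem compIn_mono {S T : Set α} (hST : S ⊆ T) (z : α) : compIn τ S z ⊆ compIn τ T z :=
  fun _ h => h.mono τ hST

/-- Components are closed under chains inside the set. [cite: Balaban1989LargeFieldII, (1.84) p.386 (bookkeeping)] -/
theorem mem_compIn_of_connIn {S : Set α} {z z' z'' : α} (hz' : z' ∈ compIn τ S z) (h : ConnIn τ S z' z'') : z'' ∈ compIn τ S z :=
  ConnIn.trans τ hz' h

/-- The absorbed part of `S` (reference region `R`, `Node00/TwoRunSiteComponents.absorbed`) is the union of the components of `S` through the points of `S ∩ R`.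
[cite: Balaban1989LargeFieldII, (1.85) p.386 (bookkeeping)] -/
theorem mem_absorbed_iff_exists_compIn (R S : Set α) (z : α) : z ∈ absorbed τ R S ↔ ∃ z₀, z₀ ∈ S ∧ z₀ ∈ R ∧ z ∈ compIn τ S z₀ := by
  rw [mem_absorbed_iff]
  constructor
  · rintro ⟨-, z₀, h₀, h₀R, hc⟩
    exact ⟨z₀, h₀, h₀R, hc⟩
  · rintro ⟨z₀, h₀, h₀R, hc⟩
    exact ⟨ConnIn.mem τ hc h₀, z₀, h₀, h₀R, hc⟩

/-- **`S` HAS A BIG COMPONENT** for the size criterion `big` (a DIAL: which sets count as big): some point of `S` has a big component.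
[cite: Balaban1989LargeFieldII, (1.80) p.384 (bookkeeping)] -/
def HasBigComponent (big : Set α → Prop) (S : Set α) : Prop :=
  ∃ z ∈ S, big (compIn τ S z)

/-- Unfolding. [cite: Balaban1989LargeFieldII, (1.80) p.384 (bookkeeping)] -/
theorem hasBigComponent_iff (big : Set α → Prop) (S : Set α) : HasBigComponent τ big S ↔ ∃ z ∈ S, big (compIn τ S z) :=
  Iff.rfl

/-- A set with a big component is nonempty. [cite: Balaban1989LargeFieldII, (1.80) p.384 (bookkeeping)] -/
theorem HasBigComponent.nonempty {big : Set α → Prop} {S : Set α} (h : HasBigComponent τ big S) : S.Nonempty :=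
  let ⟨z, hz, _⟩ := h
  ⟨z, hz⟩

/-- Weakening the size criterion keeps the booking (monotone in the dial). [cite: Balaban1989LargeFieldII, (1.80) p.384 (bookkeeping)] -/
theorem HasBigComponent.mono {big big' : Set α → Prop} (hb : ∀ C, big C → big' C) {S : Set α} (h : HasBigComponent τ big S) :
    HasBigComponent τ big' S :=
  let ⟨z, hz, hC⟩ := h
  ⟨z, hz, hb _ hC⟩

/-- **THE `⊤` DIAL READS NON-EMPTINESS**: when every set counts as big, `S` has a big component iff `S ≠ ∅`. [cite: Balaban1988Convergent, (2.18) p.257 (bookkeeping)] -/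
theorem hasBigComponent_top_iff (S : Set α) : HasBigComponent τ (fun _ => True) S ↔ S.Nonempty :=
  ⟨fun h => h.nonempty τ, fun ⟨z, hz⟩ => ⟨z, hz, trivial⟩⟩

/-- **THE `⊥` DIAL READS NOTHING**. [cite: Balaban1988Convergent, (2.18) p.257 (bookkeeping)] -/
theorem not_hasBigComponent_bot (S : Set α) : ¬ HasBigComponent τ (fun _ => False) S :=
  fun ⟨_, _, h⟩ => h

/-- The empty set has no big component, whatever the dial. [cite: Balaban1989LargeFieldI, (0.2) p.176 (bookkeeping)] -/
theorem not_hasBigComponent_empty (big : Set α → Prop) : ¬ HasBigComponent τ big ∅ :=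
  fun ⟨_, hz, _⟩ => hz

/-- For a set-monotone dial the booking grows with the set (components grow, `compIn_mono`). [cite: Balaban1989LargeFieldII, (1.85) p.386 (bookkeeping)] -/
theorem HasBigComponent.of_subset {big : Set α → Prop} (hbig : ∀ C C', C ⊆ C' → big C → big C') {S T : Set α} (hST : S ⊆ T)
    (h : HasBigComponent τ big S) : HasBigComponent τ big T :=
  let ⟨z, hz, hC⟩ := h
  ⟨z, hST hz, hbig _ _ (compIn_mono τ hST z) hC⟩

end Components

/-! ## §2  The component-size reading of a key -/

section Key

variable {α : Type*} (τ : α → α → Prop)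

/-- **THE COMPONENT-SIZE («OVER-AGE») READING**: the key `x = (Ω-sequence, Λ-sequence)` is booked at cut `jcut` iff at some level `1 ≤ j ≤ jcut` the large-field region
`Z_j = Λ_jᶜ` has a component that is big for its level (`big j`). [cite: Balaban1989LargeFieldII, (1.80) p.384 (bookkeeping); Balaban1988Convergent, (2.18) p.257 (bookkeeping)] -/
def KeyBigOldComponent (big : ℕ → Set α → Prop) (jcut : ℕ) (x : (ℕ → Set α) × (ℕ → Set α)) : Prop :=
  ∃ j, 1 ≤ j ∧ j ≤ jcut ∧ HasBigComponent τ (big j) (x.2 j)ᶜ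

/-- Unfolding. [cite: Balaban1989LargeFieldII, (1.80) p.384 (bookkeeping)] -/
theorem keyBigOldComponent_iff (big : ℕ → Set α → Prop) (jcut : ℕ) (x : (ℕ → Set α) × (ℕ → Set α)) :
    KeyBigOldComponent τ big jcut x ↔ ∃ j, 1 ≤ j ∧ j ≤ jcut ∧ HasBigComponent τ (big j) (x.2 j)ᶜ :=
  Iff.rfl

/-- ★ **EVERY DIAL VALUE IS A SUB-READING OF THE RECORD's**: a key booked by the component-size reading carries an old large-field region at the same cut
(`Node00/TwoRunSitePersistence.KeyOldLargeField`). [cite: Balaban1988Convergent, (2.18) p.257 (bookkeeping)] -/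
theorem keyOldLargeField_of_keyBigOldComponent {big : ℕ → Set α → Prop} {jcut : ℕ} {x : (ℕ → Set α) × (ℕ → Set α)}
    (h : KeyBigOldComponent τ big jcut x) : KeyOldLargeField jcut x := by
  obtain ⟨j, h1, hj, hb⟩ := h
  exact ⟨j, h1, hj, Set.nonempty_compl.mp (hb.nonempty τ)⟩

/-- A dial under which EVERY component through a point of its set counts reads the record's persistence reading. [cite: Balaban1988Convergent, (2.18) p.257 (bookkeeping)] -/
theorem keyBigOldComponent_iff_keyOldLargeField_of_compIn {big : ℕ → Set α → Prop} (hbig : ∀ j (S : Set α) z, z ∈ S → big j (compIn τ S z)) (jcut : ℕ)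
    (x : (ℕ → Set α) × (ℕ → Set α)) : KeyBigOldComponent τ big jcut x ↔ KeyOldLargeField jcut x := by
  refine ⟨keyOldLargeField_of_keyBigOldComponent τ, ?_⟩
  rintro ⟨j, h1, hj, hne⟩
  obtain ⟨z, hz⟩ := Set.nonempty_compl.mpr hne
  exact ⟨j, h1, hj, z, hz, hbig j _ z hz⟩

/-- ★ **THE `⊤` CORNER IS THE RECORD's PERSISTENCE READING**: when every component counts, «an old big component» ⟺ «an old large-field region».
[cite: Balaban1988Convergent, (2.18) p.257 (bookkeeping)] -/
theorem keyBigOldComponent_top_iff (jcut : ℕ) (x : (ℕ → Set α) × (ℕ → Set α)) :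
    KeyBigOldComponent τ (fun _ _ => True) jcut x ↔ KeyOldLargeField jcut x :=
  keyBigOldComponent_iff_keyOldLargeField_of_compIn τ (fun _ _ _ _ => trivial) jcut x

/-- **THE `⊥` CORNER BOOKS NOTHING** (the cut-zero face at every cut). [cite: Balaban1988Convergent, (2.18) p.257 (bookkeeping)] -/
theorem not_keyBigOldComponent_bot (jcut : ℕ) (x : (ℕ → Set α) × (ℕ → Set α)) : ¬ KeyBigOldComponent τ (fun _ _ => False) jcut x :=
  fun ⟨j, _, _, hb⟩ => not_hasBigComponent_bot τ (x.2 j)ᶜ hb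

/-- Cut `0` books nothing. [cite: Balaban1988Convergent, (2.18) p.257 (bookkeeping)] -/
theorem not_keyBigOldComponent_zero (big : ℕ → Set α → Prop) (x : (ℕ → Set α) × (ℕ → Set α)) : ¬ KeyBigOldComponent τ big 0 x :=
  fun ⟨_, h1, hj, _⟩ => Nat.not_succ_le_zero _ (h1.trans hj)

/-- Monotone in the cut. [cite: Balaban1988Convergent, (2.18) p.257 (bookkeeping)] -/
theorem KeyBigOldComponent.mono_cut {big : ℕ → Set α → Prop} {jcut jcut' : ℕ} (hle : jcut ≤ jcut') {x : (ℕ → Set α) × (ℕ → Set α)}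
    (h : KeyBigOldComponent τ big jcut x) : KeyBigOldComponent τ big jcut' x :=
  let ⟨j, h1, hj, hb⟩ := h
  ⟨j, h1, hj.trans hle, hb⟩

/-- Monotone in the dial: weakening the size criterion at every level keeps every booking. [cite: Balaban1989LargeFieldII, (1.80) p.384 (bookkeeping)] -/
theorem KeyBigOldComponent.mono_big {big big' : ℕ → Set α → Prop} (hb : ∀ j C, big j C → big' j C) {jcut : ℕ} {x : (ℕ → Set α) × (ℕ → Set α)}
    (h : KeyBigOldComponent τ big jcut x) : KeyBigOldComponent τ big' jcut x :=
  let ⟨j, h1, hj, hC⟩ := h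
  ⟨j, h1, hj, hC.mono τ (hb j)⟩

/-- LEVEL BOOKKEEPING: booked at cut `jcut + 1` ⟺ booked at cut `jcut`, or the level `jcut + 1` itself carries a big component.
[cite: Balaban1988Convergent, (2.18) p.257 (bookkeeping)] -/
theorem keyBigOldComponent_succ_iff (big : ℕ → Set α → Prop) (jcut : ℕ) (x : (ℕ → Set α) × (ℕ → Set α)) :
    KeyBigOldComponent τ big (jcut + 1) x ↔ KeyBigOldComponent τ big jcut x ∨ HasBigComponent τ (big (jcut + 1)) (x.2 (jcut + 1))ᶜ := by
  constructor
  · rintro ⟨j, h1, hj, hb⟩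
    rcases Nat.lt_or_eq_of_le hj with hlt | rfl
    · exact Or.inl ⟨j, h1, Nat.le_of_lt_succ hlt, hb⟩
    · exact Or.inr hb
  · rintro (h | h)
    · exact h.mono_cut τ (Nat.le_succ jcut)
    · exact ⟨jcut + 1, Nat.succ_le_succ (Nat.zero_le jcut), le_rfl, h⟩

/-- The all-small key is never booked. [cite: Balaban1989LargeFieldI, (0.2) p.176 (bookkeeping)] -/
theorem not_keyBigOldComponent_of_allSmall {big : ℕ → Set α → Prop} {jcut : ℕ} {x : (ℕ → Set α) × (ℕ → Set α)}
    (hx : ∀ j, 1 ≤ j → x.2 j = Set.univ) : ¬ KeyBigOldComponent τ big jcut x := by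
  rintro ⟨j, h1, -, hb⟩
  have hne := Set.nonempty_compl.mp (hb.nonempty τ)
  exact hne (hx j h1)

/-- A level whose small-field region is everything carries no big component. [cite: Balaban1989LargeFieldI, (0.2) p.176 (bookkeeping)] -/
theorem not_hasBigComponent_compl_of_eq_univ {big : Set α → Prop} {Λ : Set α} (h : Λ = Set.univ) : ¬ HasBigComponent τ big Λᶜ := by
  rw [h, Set.compl_univ]
  exact not_hasBigComponent_empty τ big

/-- ★ **COMPOSED WITH THE LEVEL WINDOW** (`Node00/TwoRunSiteWindow.windowKey c`): on the window key only the levels `c < j ≤ jcut` are read.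
[cite: Balaban1989LargeFieldII, (1.80) p.384 (bookkeeping)] -/
theorem keyBigOldComponent_windowKey_iff (big : ℕ → Set α → Prop) (jcut c : ℕ) (x : (ℕ → Set α) × (ℕ → Set α)) :
    KeyBigOldComponent τ big jcut (windowKey c x) ↔ ∃ j, c < j ∧ j ≤ jcut ∧ HasBigComponent τ (big j) (x.2 j)ᶜ := by
  constructor
  · rintro ⟨j, h1, hj, hb⟩
    by_cases hjc : j ≤ c
    · exact (not_hasBigComponent_compl_of_eq_univ τ (windowKey_snd_of_le c x h1 hjc) hb).elim
    · refine ⟨j, not_le.mp hjc, hj, ?_⟩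
      rwa [windowKey_snd, if_neg (fun h => hjc h.2)] at hb
  · rintro ⟨j, hcj, hj, hb⟩
    refine ⟨j, Nat.one_le_of_lt hcj, hj, ?_⟩
    rwa [windowKey_snd, if_neg (fun h => (not_le.mpr hcj) h.2)]

/-- GROWTH ALONG A CUMULATIVE KEY: if the small-field sequence is antitone from level `j` to level `j'` (`Λ_{j'} ⊆ Λ_j`, [III] (2.1)) and the dial is set-monotone and
level-blind, a big component at level `j` is still booked at level `j'`. [cite: Balaban1988Convergent, (2.1) p.254 (bookkeeping)] -/
theorem hasBigComponent_of_antitone {big : Set α → Prop} (hbig : ∀ C C', C ⊆ C' → big C → big C') {x : (ℕ → Set α) × (ℕ → Set α)} {j j' : ℕ}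
    (hanti : x.2 j' ⊆ x.2 j) (h : HasBigComponent τ big (x.2 j)ᶜ) : HasBigComponent τ big (x.2 j')ᶜ :=
  h.of_subset τ hbig (Set.compl_subset_compl.mpr hanti)

end Key

/-! ## §3  The cardinality dial: a component is big at level `j` iff it has at least `m j` points -/

section Card

variable {α : Type*} (τ : α → α → Prop)

/-- **THE CARDINALITY DIAL** with threshold sequence `m`: at level `j` a set is big iff it has at least `m j` elements (`Set.ncard`; an infinite set has `ncard = 0`, irrelevant on
the finite torus). [cite: Balaban1989LargeFieldII, (1.80) p.384 (bookkeeping)] -/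
def bigOfCard (m : ℕ → ℕ) (j : ℕ) (C : Set α) : Prop :=
  m j ≤ C.ncard

/-- Unfolding. [cite: Balaban1989LargeFieldII, (1.80) p.384 (bookkeeping)] -/
theorem bigOfCard_iff (m : ℕ → ℕ) (j : ℕ) (C : Set α) : bigOfCard m j C ↔ m j ≤ C.ncard :=
  Iff.rfl

/-- Antitone in the thresholds: raising them un-books. [cite: Balaban1989LargeFieldII, (1.80) p.384 (bookkeeping)] -/
theorem bigOfCard_anti {m m' : ℕ → ℕ} (h : ∀ j, m j ≤ m' j) (j : ℕ) {C : Set α} (hC : bigOfCard m' j C) : bigOfCard m j C :=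
  (h j).trans hC

/-- Threshold `0` books every set. [cite: Balaban1988Convergent, (2.18) p.257 (bookkeeping)] -/
theorem bigOfCard_of_eq_zero {m : ℕ → ℕ} {j : ℕ} (h : m j = 0) (C : Set α) : bigOfCard m j C := by
  rw [bigOfCard_iff, h]
  exact Nat.zero_le _

/-- On a finite type the dial is set-monotone. [cite: Balaban1989LargeFieldII, (1.85) p.386 (bookkeeping)] -/
theorem bigOfCard_mono_set [Finite α] (m : ℕ → ℕ) (j : ℕ) (C C' : Set α) (h : C ⊆ C') (hC : bigOfCard m j C) : bigOfCard m j C' :=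
  hC.trans (Set.ncard_le_ncard h (Set.toFinite C'))

/-- On a finite type no set exceeds the type: a threshold above `Nat.card α` books nothing. [cite: Balaban1989LargeFieldII, (1.80) p.384 (bookkeeping)] -/
theorem not_bigOfCard_of_card_lt [Finite α] {m : ℕ → ℕ} {j : ℕ} (h : Nat.card α < m j) (C : Set α) : ¬ bigOfCard m j C := by
  intro hC
  have hle : C.ncard ≤ Nat.card α := by
    rw [← Set.ncard_univ]
    exact Set.ncard_le_ncard (Set.subset_univ C) Set.finite_univ
  exact (Nat.lt_of_le_of_lt (hC.trans hle) h).false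

/-- On a finite type threshold `1` reads non-emptiness. [cite: Balaban1988Convergent, (2.18) p.257 (bookkeeping)] -/
theorem bigOfCard_one_iff_nonempty [Finite α] {m : ℕ → ℕ} {j : ℕ} (h : m j = 1) (C : Set α) : bigOfCard m j C ↔ C.Nonempty := by
  rw [bigOfCard_iff, h, Nat.one_le_iff_ne_zero, ← pos_iff_ne_zero, Set.ncard_pos (Set.toFinite C)]

/-- ★ Threshold `0` everywhere: the cardinality reading IS the record's persistence reading. [cite: Balaban1988Convergent, (2.18) p.257 (bookkeeping)] -/
theorem keyBigOldComponent_card_iff_of_eq_zero {m : ℕ → ℕ} (hm : ∀ j, m j = 0) (jcut : ℕ) (x : (ℕ → Set α) × (ℕ → Set α)) :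
    KeyBigOldComponent τ (bigOfCard m) jcut x ↔ KeyOldLargeField jcut x :=
  keyBigOldComponent_iff_keyOldLargeField_of_compIn τ (fun j S z _ => bigOfCard_of_eq_zero (hm j) (compIn τ S z)) jcut x

/-- Threshold `1` everywhere (finite type): again the record's reading (components are nonempty). [cite: Balaban1988Convergent, (2.18) p.257 (bookkeeping)] -/
theorem keyBigOldComponent_card_iff_of_eq_one [Finite α] {m : ℕ → ℕ} (hm : ∀ j, m j = 1) (jcut : ℕ) (x : (ℕ → Set α) × (ℕ → Set α)) :
    KeyBigOldComponent τ (bigOfCard m) jcut x ↔ KeyOldLargeField jcut x :=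
  keyBigOldComponent_iff_keyOldLargeField_of_compIn τ (fun j S z _ => (bigOfCard_one_iff_nonempty (hm j) _).mpr (compIn_nonempty τ S z)) jcut x

/-- Antitone in the thresholds at the key level. [cite: Balaban1989LargeFieldII, (1.80) p.384 (bookkeeping)] -/
theorem keyBigOldComponent_card_anti {m m' : ℕ → ℕ} (h : ∀ j, m j ≤ m' j) {jcut : ℕ} {x : (ℕ → Set α) × (ℕ → Set α)}
    (hx : KeyBigOldComponent τ (bigOfCard m') jcut x) : KeyBigOldComponent τ (bigOfCard m) jcut x :=
  hx.mono_big τ fun j _ hC => bigOfCard_anti h j hC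

/-- Thresholds above the lattice size book nothing (finite type). [cite: Balaban1989LargeFieldII, (1.80) p.384 (bookkeeping)] -/
theorem not_keyBigOldComponent_card_of_card_lt [Finite α] {m : ℕ → ℕ} (hm : ∀ j, 1 ≤ j → Nat.card α < m j) (jcut : ℕ) (x : (ℕ → Set α) × (ℕ → Set α)) :
    ¬ KeyBigOldComponent τ (bigOfCard m) jcut x := by
  rintro ⟨j, h1, -, z, -, hC⟩
  exact not_bigOfCard_of_card_lt (hm j h1) _ hC

end Card

/-! ## §4  On the torus: node U5d's key with site-level touching -/

section Torus

variable {P : Params} {j : ℕ}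

/-- On the torus (touching is symmetric) components are symmetric: `z′` lies in the component through `z` iff `z` lies in the component through `z′`.
[cite: Balaban1989LargeFieldII, (1.84) p.386 (bookkeeping)] -/
theorem mem_compIn_siteTouch_comm (S : Set (Site P j)) (z z' : Site P j) : z' ∈ compIn SiteTouch S z ↔ z ∈ compIn SiteTouch S z' :=
  ⟨fun h => connIn_siteTouch_symm h, fun h => connIn_siteTouch_symm h⟩

/-- … hence two points of `S` in a common component have THE SAME component. [cite: Balaban1989LargeFieldII, (1.84) p.386 (bookkeeping)] -/
theorem compIn_siteTouch_eq_of_mem {S : Set (Site P j)} {z z' : Site P j} (h : z' ∈ compIn SiteTouch S z) : compIn SiteTouch S z' = compIn SiteTouch S z := by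
  ext w
  exact ⟨fun hw => mem_compIn_of_connIn SiteTouch h hw, fun hw => mem_compIn_of_connIn SiteTouch (connIn_siteTouch_symm h) hw⟩

variable (F : T4Family) {Kc : ℕ}

/-- **THE READING ON NODE U5d's KEY** (`SiteSeqKey F Kc`, finest sites of the step-`Kc` torus, site-level touching): nothing but `KeyBigOldComponent SiteTouch`; recorded as a
theorem so that the Summits-side bad-key reading cites one name. Cut `0` books nothing. [cite: Balaban1988Convergent, (2.18) p.257 (bookkeeping)] -/
theorem not_keyBigOldComponent_siteSeqKey_zero (big : ℕ → Set (Site (F.P Kc) 0) → Prop) (x : SiteSeqKey F Kc) :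
    ¬ KeyBigOldComponent SiteTouch big 0 x :=
  not_keyBigOldComponent_zero SiteTouch big x

/-- On node U5d's key the cardinality thresholds above the number of finest sites book nothing. [cite: Balaban1989LargeFieldII, (1.80) p.384 (bookkeeping)] -/
theorem not_keyBigOldComponent_siteSeqKey_of_card_lt {m : ℕ → ℕ} (hm : ∀ j, 1 ≤ j → Nat.card (Site (F.P Kc) 0) < m j) (jcut : ℕ) (x : SiteSeqKey F Kc) :
    ¬ KeyBigOldComponent SiteTouch (bigOfCard m) jcut x :=
  not_keyBigOldComponent_card_of_card_lt SiteTouch hm jcut x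

/-- ★ On node U5d's key composed with the component-wise FORGIVING window (`forgiveKeyComp F c`, floor `c ≥ 1`): a booking above the floor is a booking of the FORGIVEN
entry — an old big component of the hole that SURVIVES the filling of the floor-old components; below the floor nothing is read. [cite: Balaban1989LargeFieldII, (1.85) p.386 (bookkeeping)] -/
theorem keyBigOldComponent_forgiveKeyComp_iff {c : ℕ} (hc : 1 ≤ c) (big : ℕ → Set (Site (F.P Kc) 0) → Prop) (jcut : ℕ) (x : SiteSeqKey F Kc) :
    KeyBigOldComponent SiteTouch big jcut (forgiveKeyComp F c x) ↔
      ∃ j, c < j ∧ j ≤ jcut ∧ HasBigComponent SiteTouch (big j) (forgive SiteTouch (x.2 c)ᶜ (x.2 j))ᶜ := by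
  constructor
  · rintro ⟨j, h1, hj, hb⟩
    by_cases hjc : j ≤ c
    · exact (not_hasBigComponent_compl_of_eq_univ SiteTouch (forgiveKeyComp_snd_of_le F c x h1 hjc) hb).elim
    · refine ⟨j, not_le.mp hjc, hj, ?_⟩
      rwa [forgiveKeyComp_snd_of_lt F c x (not_le.mp hjc), floorRegion_of_one_le F hc] at hb
  · rintro ⟨j, hcj, hj, hb⟩
    refine ⟨j, Nat.one_le_of_lt hcj, hj, ?_⟩
    rwa [forgiveKeyComp_snd_of_lt F c x hcj, floorRegion_of_one_le F hc]

end Torus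

end Literature.MathematicalPhysics.QuantumFieldTheory.Balaban1983to89.Node00

end
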